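import Summits.ValiantsHypothesis.ValiantsHypothesis.Theorems.NewtonUnitEquationsTwoProductsRankOneSchemaLawPlanar
import HarnessLib

/-!
# Route NewtonUnitEquations — crux `TwoProducts` (stmt-ValiantsHypothesis-5906), line `relation_ladder`, rung R9 (the RANK-ONE
# SCHEMA law: ONE datum `(ρ⁺, ρ⁻)` of ANY shape) by the TRANSPORTATION LIFT — part 6/8 — the product-plan upstairs weights and the per-visible-point slice minimiser (T7 end, T8 start)

THE RANK-ONE SCHEMA LAW (R9): if ALL additive coincidences of the letter family of `(u, v)` are multiples of ONE datum `(ρ⁺, ρ⁻)` —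
ANY datum `ρ⁺, ρ⁻ : Expo →₀ ℕ`, no side condition — then GLOBALLY `#visible ≤ 2^{c m}(#T + 2)^c` (`c = 1416`).  This is the rank-one SCHEMA
quantified over the datum asked for by the Negative lane (val-neg-1 g4, evidence #48 on stmt-5906, item (a)); it SUBSUMES the rungs R3♯
(`permTypeLaw_proof`), R6, R6b, R6c, R7a, R7b, R7c, R8 (each of their hypotheses exhibits a datum).  Engine = the TRANSPORTATION LIFT of
val-idea-8 g3's memo `Cruxes/TwoProducts/Lines/relation_ladder_R7_engine.md` §1 / `…R8_engine.md` §5 made uniform: for the disjoint balanced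
relation `Σ_{i ∈ P} p_i • α_i = Σ_{j ∈ N} q_j • β_j` the atoms are `Z_{ij}`, `(i, j) ∈ P × N` (upstairs index type `σ ⊕ σ × σ`: free letters on
the left, atoms on the right), `Y_{α_i} ↦ ∏_j Z_{ij}^{q_j}`, `Y_{β_j} ↦ ∏_i Z_{ij}^{p_i}`; the planar push-forward is the PRODUCT PLAN
`E'(Z_{ij})_c = (α_i)_c (β_j)_c T'_{1-c}` over the `D = T'_0 T'_1`-dilated plane (`T_c = Σ_i p_i (α_i)_c`, `T' = max(T, 1)`), the upstairs
weights are the PRODUCT PLAN `θ_{ij} = r_i r_j / R` of the letter weights (pointwise positive, NOT a pull-back; balanced because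
`Σ p_i r_i = Σ q_j r_j`); the fibre over an atom monomial is parametrised by `κ = #α_{a₀}` with a CONSISTENCY guard over all `|P|·|N|` atom
equations; SLICING by the atom exponents (≤ `2^{3m}` slices through the simplex `R8.card_W_le`); the coefficient theorem
`Pfac · C(R + B_κ − 1, B_κ) · κ_κ` and the shift rank `2m(ΣA + 1)² + 1` are shape-independent (the free letters enter only through the binomial);
`ShiftRank.pencilCount` BY NAME.  Reductions: common part of the datum (`DatumExcess.rankOne_reduce`), large / absent coefficients
(`R7a.permType_of_rankOne_largeCoeff/absent`), wide sides (`permType_of_rankOne_wideSide`), and a non-permutation coincidence balances the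
datum and makes both sides non-empty (`sides_of_shift`, over val-neg-1 g4's `OneSidedMembership.weight_*` / `DatumExcess.*`).

AUTHORSHIP / LANE NOTE (val-lit-p3 g16, prover seat, KEEP lineage, helper mode `--supports stmt-ValiantsHypothesis-5906 --as helper`;
CLAIM #1 on the val-lit bus 14:45Z 2026-08-28, ★ 15:03Z; no val-idea-8 seat alive at the time — the typed target is staged for the line
owner as `HOME/lmr/staged/p3g16-R9/sketch_R9.lean`, and the closing theorem is stated by its LITERAL BODY so that a later skeleton can wire
`stub := R9.rankOneSchemaLaw_proof` by name).  Mathematics and Lean text of this module: this seat, generalising its predecessor's R8 port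
(`…RankOneOneSidedLaw*`, val-lit-p3 g15) decl by decl.  Reused BY NAME: `R6b.HSD` (+ closure lemmas), `R7b.dilE`/`piT_dilE`/`piE_dilE`,
`R7a.choose_bridge`, `R7a.permType_of_rankOne_largeCoeff/absent`, `toolBound_mono`, `tab`, `sgn`, `R6b.sum_sgn`, `rW`/`R6b.rW_pos`, `lwt_piT`,
`PlanarCell.eq_of_nsmul_eq`/`wt_sum`, `FormalLogLinearisation.wt_nsmul`, `R8.W`/`R8.card_W_le`, `ShiftRank.pencilCount`,
`BinExpSum.pencilCount_arith`, val-neg-1 g4's `DatumExcess.*`, `RankOneCoverage.eq_of_tsub_eq_zero`, `OneSidedMembership.*`.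
Namespace `…PermutationType.R9`.  Nothing here closes the line's residual (`ResidualLawV20`), the crux `TwoProducts` (5906) or `VP ≠ VNP`;
no summit statement is proved.

Honest scope: coincidence modules of RANK ≥ 2 (val-neg-1 g4's p635223 `RankTwoEscapes`) are NOT covered; after R9 the residual of the line is
«no lattice-small permutation-type contraction (R5), no cheap class cover (R1_r), coincidence rank ≥ 2».  Nothing here moves VP ≠ VNP;
`TwoProducts` (5906) / `PlanarCellBound` stay OPEN. [folklore]

Cut table (scratch `HOME/lmr/staged/p3g16-R9/R9-Scratch.lean`, 2 249 lines, rc 0 / 0 warnings / 0 sorries, axioms standard): part 1 `…Lift` =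
T2 (`GIdx`, `P`/`N`/`rel`/`rest`, `frM` and its coordinates, `Idle`, the table sums `sum_frM_inl/inr`); part 2 `…Fibres` = T3 (`xhat`, `Lrel`,
`Lof`, `Adm`, `sA`, `KR`, `eq_Lof_of_piT`, `piT_Lof`, degrees, `Bk`, `Pfac`, `kap`, `multinomial_Lof_eq`, `coeff_phiT_frM`); part 3 `…Slice` =
T4 slice functions, THE COEFFICIENT THEOREM `coeff_free_logTrunc`, T5 finite shift rank `Fsl_shift`; part 4 `…SliceExc` = the exceptional point,
`mem_support_free_logTrunc_iff`, `Fsl_zero_zero`, `xOf`, `Fsl_congr`; part 5 `…Planar` = T7 `RelDataG`, `D`, `cell`, `enumP`, `piE_enumP_frM`,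
`phi_GT`, `injOn_of_rankOne`, `lifted_of_visible`; part 6 `…Weights` = product-plan weights `θW`, `lwt_θW_frM`, `lwt_splitG`, T8
`sliceMin_of_visible`; part 7 `…Count` = `sliceCount`, `RelDataG.count`, `permType_of_rankOne_wideSide`, `sides_of_shift`, `sum_enum_smul_eq`,
`mapDomain_enum_table`; part 8 `…Law` = arithmetic (`c = 1416`), `rankOneSchemaLaw_proof`.
-/

noncomputable section

-- Sub = Summit single-conjunct layout: the duplicated namespace component is mandated by the tree.
set_option linter.dupNamespace false
set_option linter.unusedSimpArgs false
set_option linter.unusedSectionVars false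
set_option linter.unusedVariables false

namespace Summit.ValiantsHypothesis.ValiantsHypothesis.Theorems.NewtonUnitEquations.TwoProducts.PermutationType
namespace R9
open scoped BigOperators
open MvPolynomial

variable {σ : Type*} [Fintype σ] [DecidableEq σ]

variable (Itr : GIdx σ)

section GenPlanar
open Summit.ValiantsHypothesis.ValiantsHypothesis.Theorems.NewtonUnitEquations.TwoProducts.FormalLogLinearisation
open Summit.ValiantsHypothesis.ValiantsHypothesis.Theorems.NewtonUnitEquations.TwoProducts.PlanarCell

variable {m : ℕ} {u v : Fin m → MvPolynomial (Fin 2) ℂ} (Dtr : RelDataG u v)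

/-! ### The upstairs weights: the PRODUCT PLAN of the letter weights (pointwise positive, not a pull-back) -/

/-- The total `P`-side weight `R = Σ_k pI k · r_k`. [folklore] -/
def RelDataG.Rtot (ξ : Fin 2 → ℝ) : ℝ := ∑ k, (Dtr.pI k : ℝ) * rW (u := u) (v := v) ξ k

/-- `R > 0` for a valid weight. [folklore] -/
theorem RelDataG.Rtot_pos (ξ : Fin 2 → ℝ) (hval : ValidWeight u v ξ) : 0 < Dtr.Rtot ξ := by
  unfold RelDataG.Rtot
  have hle : (Dtr.pI Dtr.a₀ : ℝ) * rW (u := u) (v := v) ξ Dtr.a₀ ≤ ∑ k, (Dtr.pI k : ℝ) * rW (u := u) (v := v) ξ k :=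
    Finset.single_le_sum (f := fun k => (Dtr.pI k : ℝ) * rW (u := u) (v := v) ξ k)
      (fun k _ => mul_nonneg (Nat.cast_nonneg _) (R6b.rW_pos ξ hval k).le) (Finset.mem_univ _)
  have hpos : (0 : ℝ) < (Dtr.pI Dtr.a₀ : ℝ) * rW (u := u) (v := v) ξ Dtr.a₀ :=
    mul_pos (by exact_mod_cast Nat.pos_of_ne_zero Dtr.hpa) (R6b.rW_pos ξ hval _)
  linarith

/-- Planar weights of weighted letter sums. [folklore] -/
theorem wt_sum_nsmul (ξ : Fin 2 → ℝ) (f : Fin (sE u v) → ℕ) :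
    wt ξ (∑ k, f k • enum u v k) = ∑ k, (f k : ℝ) * wt ξ (enum u v k) := by
  rw [PlanarCell.wt_sum]
  exact Finset.sum_congr rfl fun k _ => wt_nsmul ξ (f k) (enum u v k)

/-- The two sides of the relation have the same total weight: `Σ pI k r_k = Σ qI k r_k`. [folklore] -/
theorem RelDataG.Rtot_eq (ξ : Fin 2 → ℝ) : Dtr.Rtot ξ = ∑ k, (Dtr.qI k : ℝ) * rW (u := u) (v := v) ξ k := by
  have h := congrArg (wt ξ) Dtr.hrel
  rw [wt_sum_nsmul, wt_sum_nsmul] at h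
  unfold RelDataG.Rtot rW
  have e1 : ∑ k, (Dtr.pI k : ℝ) * -wt ξ (enum u v k) = -∑ k, (Dtr.pI k : ℝ) * wt ξ (enum u v k) := by
    rw [← Finset.sum_neg_distrib]; exact Finset.sum_congr rfl fun k _ => by ring
  have e2 : ∑ k, (Dtr.qI k : ℝ) * -wt ξ (enum u v k) = -∑ k, (Dtr.qI k : ℝ) * wt ξ (enum u v k) := by
    rw [← Finset.sum_neg_distrib]; exact Finset.sum_congr rfl fun k _ => by ring
  rw [e1, e2, h]

/-- The PRODUCT-PLAN upstairs weights: `θ(inl k) = r_k`, `θ(Z_{ij}) = r_i r_j / R`. [folklore] -/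
def RelDataG.θW (ξ : Fin 2 → ℝ) : Fin (sE u v) ⊕ Fin (sE u v) × Fin (sE u v) → ℝ
  | Sum.inl k => rW (u := u) (v := v) ξ k
  | Sum.inr ij => rW (u := u) (v := v) ξ ij.1 * rW (u := u) (v := v) ξ ij.2 / Dtr.Rtot ξ

/-- Pointwise positivity of the product-plan weights. [folklore] -/
theorem RelDataG.θW_pos (ξ : Fin 2 → ℝ) (hval : ValidWeight u v ξ) (t : Fin (sE u v) ⊕ Fin (sE u v) × Fin (sE u v)) :
    0 < Dtr.θW ξ t := by
  rcases t with k | ⟨i, j⟩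
  · exact R6b.rW_pos ξ hval k
  · exact div_pos (mul_pos (R6b.rW_pos ξ hval i) (R6b.rW_pos ξ hval j)) (Dtr.Rtot_pos ξ hval)

/-- **The product plan balances the weights**: `θ(frM k) = r_k` for every letter `k`. [folklore] -/
theorem RelDataG.lwt_θW_frM (ξ : Fin 2 → ℝ) (hval : ValidWeight u v ξ) (k : Fin (sE u v)) :
    lwt (Dtr.θW ξ) (frM Dtr.idx k) = rW (u := u) (v := v) ξ k := by
  classical
  have hR : Dtr.Rtot ξ ≠ 0 := (Dtr.Rtot_pos ξ hval).ne'
  have e0 : lwt (Dtr.θW ξ) (frM Dtr.idx k) = ∑ t, ((frM Dtr.idx k t : ℕ) : ℝ) * Dtr.θW ξ t := by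
    unfold lwt; exact Finset.sum_congr rfl fun t _ => mul_comm _ _
  rw [e0, Fintype.sum_sum_type, Fintype.sum_prod_type]
  simp only [RelDataG.θW]
  rw [sum_frM_inl Dtr.idx (R := ℝ) (fun k' => rW (u := u) (v := v) ξ k') k,
    sum_frM_inr Dtr.idx (R := ℝ) (fun i j => rW (u := u) (v := v) ξ i * rW (u := u) (v := v) ξ j / Dtr.Rtot ξ) k, Dtr.idx_pf, Dtr.idx_qf]
  have eP : ∑ i ∈ P Dtr.idx, (Dtr.pI i : ℝ) * (rW (u := u) (v := v) ξ i * rW (u := u) (v := v) ξ k / Dtr.Rtot ξ) = rW (u := u) (v := v) ξ k := by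
    rw [Dtr.sum_P_pI (R := ℝ)]
    have : ∑ i, (Dtr.pI i : ℝ) * (rW (u := u) (v := v) ξ i * rW (u := u) (v := v) ξ k / Dtr.Rtot ξ) = (∑ i, (Dtr.pI i : ℝ) * rW (u := u) (v := v) ξ i) * (rW (u := u) (v := v) ξ k / Dtr.Rtot ξ) := by
      rw [Finset.sum_mul]; exact Finset.sum_congr rfl fun i _ => by ring
    rw [this]; unfold RelDataG.Rtot at hR ⊢; field_simp
  have eN : ∑ j ∈ N Dtr.idx, (Dtr.qI j : ℝ) * (rW (u := u) (v := v) ξ k * rW (u := u) (v := v) ξ j / Dtr.Rtot ξ) = rW (u := u) (v := v) ξ k := by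
    rw [Dtr.sum_N_qI (R := ℝ)]
    have : ∑ j, (Dtr.qI j : ℝ) * (rW (u := u) (v := v) ξ k * rW (u := u) (v := v) ξ j / Dtr.Rtot ξ) = (∑ j, (Dtr.qI j : ℝ) * rW (u := u) (v := v) ξ j) * (rW (u := u) (v := v) ξ k / Dtr.Rtot ξ) := by
      rw [Finset.sum_mul]; exact Finset.sum_congr rfl fun j _ => by ring
    rw [this, ← Dtr.Rtot_eq]; field_simp
  by_cases hk : Dtr.pI k = 0 ∧ Dtr.qI k = 0
  · rw [if_pos hk, if_neg (by simpa using hk.1), if_neg (by simpa using hk.2), add_zero, add_zero]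
  · rw [if_neg hk, zero_add]
    rcases Dtr.hdisj k with hp | hq
    · have hq : Dtr.qI k ≠ 0 := fun h => hk ⟨hp, h⟩
      rw [if_neg (by simpa using hp), if_pos hq, zero_add, eP]
    · have hp : Dtr.pI k ≠ 0 := fun h => hk ⟨h, hq⟩
      rw [if_pos hp, if_neg (by simpa using hq), add_zero, eN]

/-- The product-plan weight of a toric image is the letter weight of its source: `θ(π_frM L) = -wt ξ (π_enum L)`. [folklore] -/
theorem RelDataG.lwt_θW_piT (ξ : Fin 2 → ℝ) (hval : ValidWeight u v ξ) (L : Fin (sE u v) →₀ ℕ) :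
    lwt (Dtr.θW ξ) (piT (frM Dtr.idx) L) = -wt ξ (piE (enum u v) L) := by
  rw [lwt_piT]
  simp only [Dtr.lwt_θW_frM ξ hval]
  exact lwt_eq_neg_wt ξ (enum u v) L

/-- On the lifted support the product-plan weight is `-wt ξ` of the dilated push-forward over `D`. [folklore] -/
theorem RelDataG.lwt_θW_of_mem (ξ : Fin 2 → ℝ) (hval : ValidWeight u v ξ)
    (x : Fin (sE u v) ⊕ Fin (sE u v) × Fin (sE u v) →₀ ℕ) (hx : x ∈ Dtr.GT.support) :
    lwt (Dtr.θW ξ) x = -wt ξ (piE Dtr.enumP x) / Dtr.D := by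
  obtain ⟨L, -, rfl⟩ := Dtr.exists_of_mem_support_GT x hx
  rw [Dtr.lwt_θW_piT ξ hval L, Dtr.piE_enumP_piT, wt_nsmul]
  have hD : (Dtr.D : ℝ) ≠ 0 := by exact_mod_cast (show Dtr.D ≠ 0 by have := Dtr.D_pos; omega)
  field_simp

/-- Splitting a linear weight along the slices: `θ(x) = Σ_k θ_{inl k} x̂_k + Σ_{atoms} θ_{ij} x_{ij}` (idle-free `x`). [folklore] -/
theorem lwt_splitG (θ : σ ⊕ σ × σ → ℝ) (x : σ ⊕ σ × σ →₀ ℕ) (hx : Idle Itr x) :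
    lwt θ x = (∑ k, θ (Sum.inl k) * ((xhat Itr x k : ℕ) : ℝ)) +
      ∑ i ∈ P Itr, ∑ j ∈ N Itr, θ (Sum.inr (i, j)) * ((x (Sum.inr (i, j)) : ℕ) : ℝ) := by
  classical
  unfold lwt
  rw [Fintype.sum_sum_type]
  congr 1
  · refine Finset.sum_congr rfl fun k _ => ?_
    by_cases hk : Itr.pf k = 0 ∧ Itr.qf k = 0
    · rw [xhat_rest Itr x ((mem_rest Itr k).2 hk)]
    · rw [xhat_rel Itr x ((mem_rel Itr k).2 hk), hx.1 k hk]
  · rw [← Finset.sum_product (s := P Itr) (t := N Itr) (f := fun ij => θ (Sum.inr ij) * ((x (Sum.inr ij) : ℕ) : ℝ))]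
    symm
    refine Finset.sum_subset (Finset.subset_univ _) fun ij _ hij => ?_
    rcases ij with ⟨i, j⟩
    rw [Finset.mem_product, mem_P, mem_N] at hij
    rw [hx.2 i j hij]; simp

end GenPlanar

/-! ## Part T8: per visible point a zero-avoiding strict pencil-minimiser of a slice function (with a letter multiset of degree `≤ m`
over it); slices counted through the simplex of restricted letter multisets; the fibrewise count via `ShiftRank.pencilCount` -/

section GenCount
open Summit.ValiantsHypothesis.ValiantsHypothesis.Theorems.NewtonUnitEquations.TwoProducts.FormalLogLinearisation
open Summit.ValiantsHypothesis.ValiantsHypothesis.Theorems.NewtonUnitEquations.TwoProducts.PlanarCell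

/-- `xOf b ν` reads `b` only on the atoms. [folklore] -/
theorem xOf_congr {b b' : σ × σ → ℕ} (h : ∀ i ∈ P Itr, ∀ j ∈ N Itr, b (i, j) = b' (i, j)) (ν : σ → ℕ) :
    xOf Itr b ν = xOf Itr b' ν := by
  ext t
  rcases t with k | ⟨i, j⟩
  · rw [xOf_inl, xOf_inl]
  · rw [xOf_inr, xOf_inr]
    by_cases hij : Itr.pf i ≠ 0 ∧ Itr.qf j ≠ 0
    · rw [if_pos hij, if_pos hij, h i ((mem_P Itr i).2 hij.1) j ((mem_N Itr j).2 hij.2)]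
    · rw [if_neg hij, if_neg hij]

/-- The atom mass of the toric image of a letter multiset of degree `≤ m` (coefficients `≤ m`, at most `m` letters on each side) is
`≤ 2 m³`. [folklore] -/
theorem sA_piT_le {m : ℕ} (hp : ∀ k, Itr.pf k ≤ m) (hq : ∀ k, Itr.qf k ≤ m) (hP : (P Itr).card ≤ m) (hN : (N Itr).card ≤ m)
    (L : σ →₀ ℕ) (hL : deg L ≤ m) : sA Itr (fun ij => piT (frM Itr) L (Sum.inr ij)) ≤ 2 * (m * m * m) := by
  classical
  have hdeg := deg_eq_sum L
  have hPL : ∑ i ∈ P Itr, L i ≤ m :=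
    (Finset.sum_le_sum_of_subset_of_nonneg (Finset.subset_univ (P Itr)) fun _ _ _ => Nat.zero_le _).trans (by rw [← hdeg]; exact hL)
  have hNL : ∑ j ∈ N Itr, L j ≤ m :=
    (Finset.sum_le_sum_of_subset_of_nonneg (Finset.subset_univ (N Itr)) fun _ _ _ => Nat.zero_le _).trans (by rw [← hdeg]; exact hL)
  have hqs : ∑ j ∈ N Itr, Itr.qf j ≤ m * m :=
    calc ∑ j ∈ N Itr, Itr.qf j ≤ ∑ _j ∈ N Itr, m := Finset.sum_le_sum fun j _ => hq j
      _ = (N Itr).card * m := by rw [Finset.sum_const, smul_eq_mul]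
      _ ≤ m * m := Nat.mul_le_mul_right _ hN
  have hps : ∑ i ∈ P Itr, Itr.pf i ≤ m * m :=
    calc ∑ i ∈ P Itr, Itr.pf i ≤ ∑ _i ∈ P Itr, m := Finset.sum_le_sum fun i _ => hp i
      _ = (P Itr).card * m := by rw [Finset.sum_const, smul_eq_mul]
      _ ≤ m * m := Nat.mul_le_mul_right _ hP
  unfold sA
  have hcoord : ∀ i ∈ P Itr, ∀ j ∈ N Itr, piT (frM Itr) L (Sum.inr (i, j)) = Itr.qf j * L i + Itr.pf i * L j :=
    fun i hi j hj => piT_frM_atom Itr L hi hj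
  rw [Finset.sum_congr rfl fun i hi => Finset.sum_congr rfl fun j hj => hcoord i hi j hj]
  have e : ∑ i ∈ P Itr, ∑ j ∈ N Itr, (Itr.qf j * L i + Itr.pf i * L j) =
      (∑ i ∈ P Itr, L i) * (∑ j ∈ N Itr, Itr.qf j) + (∑ i ∈ P Itr, Itr.pf i) * (∑ j ∈ N Itr, L j) := by
    rw [Finset.sum_mul, Finset.sum_mul, ← Finset.sum_add_distrib]
    refine Finset.sum_congr rfl fun i _ => ?_
    rw [Finset.mul_sum, Finset.mul_sum, ← Finset.sum_add_distrib]
    exact Finset.sum_congr rfl fun j _ => by ring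
  rw [e]
  have h1 : (∑ i ∈ P Itr, L i) * (∑ j ∈ N Itr, Itr.qf j) ≤ m * (m * m) := Nat.mul_le_mul hPL hqs
  have h2 : (∑ i ∈ P Itr, Itr.pf i) * (∑ j ∈ N Itr, L j) ≤ (m * m) * m := Nat.mul_le_mul hps hNL
  calc (∑ i ∈ P Itr, L i) * (∑ j ∈ N Itr, Itr.qf j) + (∑ i ∈ P Itr, Itr.pf i) * (∑ j ∈ N Itr, L j)
      ≤ m * (m * m) + (m * m) * m := Nat.add_le_add h1 h2
    _ = 2 * (m * m * m) := by ring

omit [Fintype σ] in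
/-- **Supported simplex count**: functions `σ → ℕ` vanishing off `T` with `Σ_T f ≤ n` number at most `2^(n + #T)`
(through the simplex `R8.W #T n`). [folklore] -/
theorem card_supported_le (T : Finset σ) (n : ℕ) (F : Finset (σ → ℕ)) (hzero : ∀ f ∈ F, ∀ j, j ∉ T → f j = 0)
    (hsum : ∀ f ∈ F, ∑ j ∈ T, f j ≤ n) : F.card ≤ 2 ^ (n + T.card) := by
  classical
  set e := T.equivFin with he
  set φ : (σ → ℕ) → (Fin T.card → ℕ) := fun f i => f (e.symm i : ↥T) with hφ
  have hmaps : ∀ f ∈ F, φ f ∈ R8.W T.card n := by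
    intro f hf
    rw [R8.mem_W]
    have h1 : ∑ i, φ f i = ∑ x : ↥T, f x := by
      rw [hφ]
      exact Fintype.sum_equiv e.symm (fun i => f (e.symm i : ↥T)) (fun x => f x) fun i => rfl
    rw [h1, Finset.sum_coe_sort T (fun j => f j)]
    exact hsum f hf
  have hinj : Set.InjOn φ ↑F := by
    intro f hf g hg hfg
    funext j
    by_cases hj : j ∈ T
    · have := congrFun hfg (e ⟨j, hj⟩)
      simpa [hφ] using this
    · rw [hzero f hf j hj, hzero g hg j hj]
  calc F.card ≤ (R8.W T.card n).card := Finset.card_le_card_of_injOn φ hmaps hinj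
    _ ≤ 2 ^ (n + T.card) := R8.card_W_le _ _

/-- The uniform width surrogate `N_m = 2 m (2 m³ + 1)^2 + 1 ≥ |SIdxG m s|` (`s ≤ 2 m³`). [folklore] -/
def NmG (m : ℕ) : ℕ := 2 * m * (2 * (m * m * m) + 1) ^ 2 + 1

/-- The slice bound, uniform in the atom mass `≤ 2 m³`. [folklore] -/
def sliceBdG (m s : ℕ) : ℕ := (s + 2) ^ 3 * (NmG m + 2) ^ (3 * (Nat.log 2 (NmG m + 2) + 1))

variable {m : ℕ} {u v : Fin m → MvPolynomial (Fin 2) ℂ} (Dtr : RelDataG u v)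

/-- **Per visible point.** A visible point `l` (valid `ξ`) yields an idle-free toric point `x₀` over `D · l`, the image of a letter
multiset of degree `≤ m`, whose reduced exponent `x̂₀` is a zero-avoiding STRICT minimiser of the letter-weight functional on
`{ν : F_{x₀|atoms}(ν) ≠ 0}` over ALL of `ℕ^s`. [folklore] -/
theorem RelDataG.sliceMin_of_visible (hinj : Set.InjOn (piE Dtr.enumP) ↑Dtr.GT.support) (ξ : Fin 2 → ℝ)
    (hval : ValidWeight u v ξ) (l : Expo) (htop : IsStrictTop ξ ↑(tailDiff u v).support l) :
    ∃ x₀ : Fin (sE u v) ⊕ Fin (sE u v) × Fin (sE u v) →₀ ℕ, piE Dtr.enumP x₀ = Dtr.D • l ∧ Idle Dtr.idx x₀ ∧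
      (∃ L₀ : Fin (sE u v) →₀ ℕ, deg L₀ ≤ m ∧ piT (frM Dtr.idx) L₀ = x₀) ∧
      Fsl Dtr.idx (cU u v) (cV u v) (fun ij => x₀ (Sum.inr ij)) ⇑(xhat Dtr.idx x₀) ≠ 0 ∧
      ∀ ν : Fin (sE u v) → ℕ, ν ≠ ⇑(xhat Dtr.idx x₀) → Fsl Dtr.idx (cU u v) (cV u v) (fun ij => x₀ (Sum.inr ij)) ν ≠ 0 →
        ∑ k, rW (u := u) (v := v) ξ k * ((xhat Dtr.idx x₀ k : ℕ) : ℝ) < ∑ k, rW (u := u) (v := v) ξ k * (ν k : ℝ) := by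
  classical
  obtain ⟨x₀, hx₀, hπ, hmin⟩ := Dtr.lifted_of_visible hinj ξ l htop
  obtain ⟨L₀, hL₀, hx₀L⟩ := Dtr.exists_of_mem_support_GT x₀ hx₀
  have hx₀i : Idle Dtr.idx x₀ := Dtr.idle_of_mem_support_GT x₀ hx₀
  have hdegL : deg L₀ ≤ m := deg_le_of_mem_support_liftG _ _ L₀ hL₀
  have hDpos : (0 : ℝ) < Dtr.D := by exact_mod_cast Dtr.D_pos
  -- the upstairs weights and their normalisation
  set θ : Fin (sE u v) ⊕ Fin (sE u v) × Fin (sE u v) → ℝ := Dtr.θW ξ with hθdef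
  have hθpos : ∀ t, 0 < θ t := Dtr.θW_pos ξ hval
  have hne : (Finset.univ : Finset (Fin (sE u v) ⊕ Fin (sE u v) × Fin (sE u v))).Nonempty :=
    ⟨Sum.inl Dtr.a₀, Finset.mem_univ _⟩
  set θmin : ℝ := Finset.univ.inf' hne θ with hθmin
  have hθmin_pos : 0 < θmin := by
    obtain ⟨i, -, hi⟩ := Finset.exists_mem_eq_inf' hne θ
    rw [hθmin, hi]; exact hθpos i
  have hθmin_le : ∀ i, θmin ≤ θ i := fun i => Finset.inf'_le θ (Finset.mem_univ i)
  set θ' : Fin (sE u v) ⊕ Fin (sE u v) × Fin (sE u v) → ℝ := fun i => θ i / θmin with hθ'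
  have hθ'1 : ∀ i, 1 ≤ θ' i := fun i => by
    rw [hθ']; simp only; rw [le_div_iff₀ hθmin_pos, one_mul]; exact hθmin_le i
  have hlwt' : ∀ x : Fin (sE u v) ⊕ Fin (sE u v) × Fin (sE u v) →₀ ℕ, lwt θ' x = lwt θ x / θmin := fun x => by
    unfold lwt; rw [Finset.sum_div]
    refine Finset.sum_congr rfl fun i _ => ?_
    rw [hθ']; ring
  have hlwtG : ∀ x ∈ Dtr.GT.support, lwt θ x = -wt ξ (piE Dtr.enumP x) / Dtr.D := fun x hx => Dtr.lwt_θW_of_mem ξ hval x hx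
  have hminθ' : x₀ ∈ (phiT (frM Dtr.idx) (liftG (cU u v) (cV u v))).support ∧
      ∀ x ∈ (phiT (frM Dtr.idx) (liftG (cU u v) (cV u v))).support, x ≠ x₀ → lwt θ' x₀ < lwt θ' x := by
    refine ⟨hx₀, fun x hx hne' => ?_⟩
    rw [hlwt', hlwt']
    apply div_lt_div_of_pos_right _ hθmin_pos
    rw [hlwtG x₀ hx₀, hlwtG x hx, hπ]
    apply div_lt_div_of_pos_right _ hDpos
    linarith [hmin x hx hne']
  have hA := toric_minLog (frM Dtr.idx) (frM_ne_zero Dtr.idx) θ' hθ'1 (cU u v) (cV u v) x₀ hminθ'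
  set R : ℕ := ⌊lwt θ' x₀⌋₊ + 1 with hRdef
  have hRlt : lwt θ' x₀ < R := by rw [hRdef]; push_cast; exact Nat.lt_floor_add_one _
  -- `x₀ ≠ 0` and `deg x₀ ≤ R`
  have hx₀ne : x₀ ≠ 0 := by
    intro h0
    have := mem_support_iff.mp hx₀
    apply this
    rw [h0]
    unfold RelDataG.GT
    rw [phiT_liftG, coeff_sub,
      coeff_zero_prod_eq_one _ (fun j => coeff_zero_one_add_phiT_lin (frM Dtr.idx) (frM_ne_zero Dtr.idx) _),
      coeff_zero_prod_eq_one _ (fun j => coeff_zero_one_add_phiT_lin (frM Dtr.idx) (frM_ne_zero Dtr.idx) _), sub_self]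
  have hdegR : deg x₀ ≤ R := by
    have h2 : (deg x₀ : ℝ) ≤ lwt θ' x₀ := deg_le_lwt θ' hθ'1 x₀
    have h3 : (deg x₀ : ℝ) < R := lt_of_le_of_lt h2 hRlt
    have h4 : deg x₀ < R := by exact_mod_cast h3
    omega
  have hF0 : Fsl Dtr.idx (cU u v) (cV u v) (fun ij => x₀ (Sum.inr ij)) ⇑(xhat Dtr.idx x₀) ≠ 0 :=
    (mem_support_free_logTrunc_iff Dtr.idx (cU u v) (cV u v) R x₀ hx₀i hx₀ne hdegR).mp hA.1
  refine ⟨x₀, hπ, hx₀i, ⟨L₀, hdegL, hx₀L⟩, hF0, fun ν hν hFν => ?_⟩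
  have hνrel := shape_of_Fsl_ne_zero Dtr.idx (cU u v) (cV u v) _ ν hFν
  set x' : Fin (sE u v) ⊕ Fin (sE u v) × Fin (sE u v) →₀ ℕ := xOf Dtr.idx (fun ij => x₀ (Sum.inr ij)) ν with hx'def
  have hx'i : Idle Dtr.idx x' := idle_xOf Dtr.idx _ ν
  have hxh' : ⇑(xhat Dtr.idx x') = ν := xhat_xOf Dtr.idx _ ν hνrel
  have hx'A : ∀ i ∈ P Dtr.idx, ∀ j ∈ N Dtr.idx, x' (Sum.inr (i, j)) = x₀ (Sum.inr (i, j)) :=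
    fun i hi j hj => xOf_atom Dtr.idx _ ν hi hj
  have hFx' : Fsl Dtr.idx (cU u v) (cV u v) (fun ij => x' (Sum.inr ij)) = Fsl Dtr.idx (cU u v) (cV u v) (fun ij => x₀ (Sum.inr ij)) :=
    Fsl_congr Dtr.idx (cU u v) (cV u v) hx'A
  have hne' : x' ≠ x₀ := by
    intro h; apply hν; rw [← hxh', h]
  have hx'ne : x' ≠ 0 := by
    intro hz
    have hνz : ∀ k, ν k = 0 := fun k => by
      rw [← hxh', hz]; unfold xhat; rw [ofFun_apply]; split_ifs <;> rfl
    have hb0 : sA Dtr.idx (fun ij => x₀ (Sum.inr ij)) = 0 :=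
      Finset.sum_eq_zero fun i hi => Finset.sum_eq_zero fun j hj => by
        have := hx'A i hi j hj; rw [hz] at this; exact this.symm
    exact hFν (Fsl_zero_zero Dtr.idx (cU u v) (cV u v) _ hb0 ν hνz)
  have hlt' : lwt θ' x₀ < lwt θ' x' := by
    by_cases hR' : deg x' ≤ R
    · have hmem : x' ∈ (phiT (frM Dtr.idx) (logTrunc (cU u v) (cV u v) R)).support :=
        (mem_support_free_logTrunc_iff Dtr.idx (cU u v) (cV u v) R x' hx'i hx'ne hR').mpr
          (by rw [hFx', hxh']; exact hFν)
      exact hA.2 x' hmem hne'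
    · push Not at hR'
      have h2 : (deg x' : ℝ) ≤ lwt θ' x' := deg_le_lwt θ' hθ'1 x'
      have h3 : (R : ℝ) < deg x' := by exact_mod_cast hR'
      linarith
  have hlt : lwt θ x₀ < lwt θ x' := by
    have := hlt'
    rw [hlwt', hlwt'] at this
    exact (div_lt_div_iff_of_pos_right hθmin_pos).mp this
  have hAsum : ∑ i ∈ P Dtr.idx, ∑ j ∈ N Dtr.idx, θ (Sum.inr (i, j)) * ((x' (Sum.inr (i, j)) : ℕ) : ℝ) =
      ∑ i ∈ P Dtr.idx, ∑ j ∈ N Dtr.idx, θ (Sum.inr (i, j)) * ((x₀ (Sum.inr (i, j)) : ℕ) : ℝ) :=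
    Finset.sum_congr rfl fun i hi => Finset.sum_congr rfl fun j hj => by rw [hx'A i hi j hj]
  rw [lwt_splitG Dtr.idx θ x₀ hx₀i, lwt_splitG Dtr.idx θ x' hx'i, hAsum, hxh'] at hlt
  have e1 : ∀ k, θ (Sum.inl k) = rW (u := u) (v := v) ξ k := fun k => rfl
  simp only [e1] at hlt
  linarith

end GenCount

end R9
end Summit.ValiantsHypothesis.ValiantsHypothesis.Theorems.NewtonUnitEquations.TwoProducts.PermutationType

end
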